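import Mathlib
import Literature.Topology.FourManifolds.OpenCollar

/-!
# The normal pair at a boundary point of an open collar (pointwise linear algebra)

Stub `stub_normalPairPointwise` of the crux `InformationMetricHadamard.AhHadamardFilling`
(line `einstein-bulk-transfer`).  For the open collar `κ = uncurry D.toFun : M × [0, ∞) → X` of a
compact 5-manifold with boundary `X` along the boundary embedding `ι : M → ∂X`, a smooth
`ρ ≥ 0` vanishing exactly on `∂X` with a `ḡ`-unit gradient `ν` on `∂X` (`ḡ` a `C²` metric with
`ι^*ḡ = φ g₀`), we prove: `a₀ := ∂ₜ(ρ ∘ κ)(x, 0⁺) > 0`, and there are `z ∈ TₓM`, `θ > 0` with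
`ḡ(dκ(v + s z, s θ), dκ(v + s z, s θ)) = (θ a₀)² (s² + g₀(v, v))`, namely
`(z, θ) = √φ · dκ⁻¹(ν)`.  The differential `dκ_{(x,0)}` is bijective because
`d(proj, height) ∘ dκ = id` (chain rule on `univ ×ˢ Ici 0`) and the dimensions agree.
-/

noncomputable section

set_option linter.dupNamespace false

open scoped Manifold ContDiff Topology
open Set Function Bundle Literature.Topology.FourManifolds

namespace Summit.SmoothPoincare4.SmoothPoincare4.Cruxes.AhHadamardFilling.EinsteinBulkTransfer

section Collar

variable {X : Type} [TopologicalSpace X] [ChartedSpace (EuclideanHalfSpace 5) X]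
  {b : BoundaryData (𝓡∂ 5) X (𝓡 4)} (D : b.OpenCollar)

/-- `∂M × [0, ∞)` is a set of unique differentiability in `∂M × ℝ`. -/
theorem uniqueMDiffOn_univ_prod_Ici :
    UniqueMDiffOn ((𝓡 4).prod 𝓘(ℝ, ℝ)) ((univ : Set b.carrier) ×ˢ Ici (0 : ℝ)) :=
  uniqueMDiffOn_univ.prod (uniqueMDiffOn_iff_uniqueDiffOn.2 (uniqueDiffOn_Ici 0))

/-- `(x, 0) ∈ ∂M × [0, ∞)`. -/
theorem mk_zero_mem (x : b.carrier) :
    ((x, (0 : ℝ)) : b.carrier × ℝ) ∈ ((univ : Set b.carrier) ×ˢ Ici (0 : ℝ)) :=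
  ⟨mem_univ _, self_mem_Ici⟩

/-- The open collar map is differentiable within `∂M × [0, ∞)` at `(x, 0)`. -/
theorem mdifferentiableWithinAt_toFun (x : b.carrier) :
    MDifferentiableWithinAt ((𝓡 4).prod 𝓘(ℝ, ℝ)) (𝓡∂ 5) (uncurry D.toFun)
      ((univ : Set b.carrier) ×ˢ Ici (0 : ℝ)) (x, 0) :=
  (D.contMDiffOn_toFun _ (mk_zero_mem x)).mdifferentiableWithinAt (by simp)

/-- The inverse `(proj, height)` of the collar is differentiable at the boundary point `incl x`. -/
theorem mdifferentiableAt_projHeight (x : b.carrier) :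
    MDifferentiableAt (𝓡∂ 5) ((𝓡 4).prod 𝓘(ℝ, ℝ)) D.projHeight (b.incl x) :=
  ((D.contMDiffOn_projHeight _ (D.incl_mem_region x)).contMDiffAt
    (D.isOpen_region.mem_nhds (D.incl_mem_region x))).mdifferentiableAt (by simp)

/-- **Left inverse of the collar differential**: `d(proj, height)_{ι x} ∘ dκ_{(x,0)} = id`. -/
theorem mfderiv_projHeight_comp_mfderivWithin_toFun (x : b.carrier) :
    (mfderiv (𝓡∂ 5) ((𝓡 4).prod 𝓘(ℝ, ℝ)) D.projHeight (b.incl x)).comp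
        (mfderivWithin ((𝓡 4).prod 𝓘(ℝ, ℝ)) (𝓡∂ 5) (uncurry D.toFun)
          ((univ : Set b.carrier) ×ˢ Ici (0 : ℝ)) (x, 0)) =
      ContinuousLinearMap.id ℝ
        (TangentSpace ((𝓡 4).prod 𝓘(ℝ, ℝ)) ((x, (0 : ℝ)) : b.carrier × ℝ)) := by
  have hU := uniqueMDiffOn_univ_prod_Ici (b := b) _ (mk_zero_mem x)
  rw [← mfderiv_comp_mfderivWithin_of_eq (mdifferentiableAt_projHeight D x)
    (mdifferentiableWithinAt_toFun D x) hU (D.apply_zero x)]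
  have hc : ∀ p ∈ ((univ : Set b.carrier) ×ˢ Ici (0 : ℝ)),
      (D.projHeight ∘ uncurry D.toFun) p = id p := by
    rintro ⟨y, t⟩ ⟨-, ht⟩
    exact D.projHeight_apply_toFun y ht
  rw [mfderivWithin_congr hc (hc _ (mk_zero_mem x)), mfderivWithin_id hU]

/-- Pointwise form of `mfderiv_projHeight_comp_mfderivWithin_toFun`. -/
theorem mfderiv_projHeight_apply_mfderivWithin_toFun (x : b.carrier)
    (w : TangentSpace ((𝓡 4).prod 𝓘(ℝ, ℝ)) ((x, (0 : ℝ)) : b.carrier × ℝ)) :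
    mfderiv (𝓡∂ 5) ((𝓡 4).prod 𝓘(ℝ, ℝ)) D.projHeight (b.incl x)
        (mfderivWithin ((𝓡 4).prod 𝓘(ℝ, ℝ)) (𝓡∂ 5) (uncurry D.toFun)
          ((univ : Set b.carrier) ×ˢ Ici (0 : ℝ)) (x, 0) w) = w := by
  exact DFunLike.congr_fun (mfderiv_projHeight_comp_mfderivWithin_toFun D x) w

/-- **The collar differential on horizontal vectors**: `dκ_{(x,0)} (v, 0) = dι_x v`. -/
theorem mfderivWithin_toFun_apply_inl (x : b.carrier) (v : TangentSpace (𝓡 4) x) :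
    mfderivWithin ((𝓡 4).prod 𝓘(ℝ, ℝ)) (𝓡∂ 5) (uncurry D.toFun)
        ((univ : Set b.carrier) ×ˢ Ici (0 : ℝ)) (x, 0) (v, 0) =
      mfderiv (𝓡 4) (𝓡∂ 5) b.incl x v := by
  have h1 : b.incl = uncurry D.toFun ∘ fun y : b.carrier => (y, (0 : ℝ)) :=
    funext fun y => (D.apply_zero y).symm
  have hf : MDifferentiableAt (𝓡 4) ((𝓡 4).prod 𝓘(ℝ, ℝ)) (fun y : b.carrier => (y, (0 : ℝ))) x :=
    mdifferentiableAt_id.prodMk mdifferentiableAt_const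
  have hmaps : (univ : Set b.carrier) ⊆
      (fun y : b.carrier => (y, (0 : ℝ))) ⁻¹' ((univ : Set b.carrier) ×ˢ Ici (0 : ℝ)) :=
    fun y _ => ⟨mem_univ _, self_mem_Ici⟩
  rw [h1, ← mfderivWithin_univ, mfderivWithin_comp x (mdifferentiableWithinAt_toFun D x)
    hf.mdifferentiableWithinAt hmaps (uniqueMDiffWithinAt_univ _), mfderivWithin_univ,
    mfderiv_prod_left]
  rfl

/-- **The normal derivative along the collar**: `∂ₜ(ρ ∘ κ)(x, 0⁺) = dρ (dκ_{(x,0)} (0, 1))`. -/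
theorem derivWithin_comp_toFun (x : b.carrier) {ρ : X → ℝ}
    (hρ : MDifferentiableAt (𝓡∂ 5) 𝓘(ℝ, ℝ) ρ (b.incl x)) :
    derivWithin (fun t => ρ (D.toFun x t)) (Ici 0) 0 =
      mfderiv (𝓡∂ 5) 𝓘(ℝ, ℝ) ρ (b.incl x)
        (mfderivWithin ((𝓡 4).prod 𝓘(ℝ, ℝ)) (𝓡∂ 5) (uncurry D.toFun)
          ((univ : Set b.carrier) ×ˢ Ici (0 : ℝ)) (x, 0) (0, 1)) := by
  have hU := uniqueMDiffOn_univ_prod_Ici (b := b) _ (mk_zero_mem x)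
  have hc : MDifferentiableAt 𝓘(ℝ, ℝ) ((𝓡 4).prod 𝓘(ℝ, ℝ))
      (fun t : ℝ => ((x, t) : b.carrier × ℝ)) 0 :=
    mdifferentiableAt_const.prodMk mdifferentiableAt_id
  have hmaps : Ici (0 : ℝ) ⊆
      (fun t : ℝ => ((x, t) : b.carrier × ℝ)) ⁻¹' ((univ : Set b.carrier) ×ˢ Ici (0 : ℝ)) :=
    fun t ht => ⟨mem_univ _, ht⟩
  have hU1 : UniqueMDiffWithinAt 𝓘(ℝ, ℝ) (Ici (0 : ℝ)) 0 :=
    (uniqueDiffWithinAt_Ici 0).uniqueMDiffWithinAt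
  have hρκ : MDifferentiableWithinAt ((𝓡 4).prod 𝓘(ℝ, ℝ)) 𝓘(ℝ, ℝ) (ρ ∘ uncurry D.toFun)
      ((univ : Set b.carrier) ×ˢ Ici (0 : ℝ)) (x, 0) :=
    hρ.comp_mdifferentiableWithinAt_of_eq _ (mdifferentiableWithinAt_toFun D x) (D.apply_zero x)
  have key : mfderivWithin 𝓘(ℝ, ℝ) 𝓘(ℝ, ℝ) (fun t => ρ (D.toFun x t)) (Ici 0) 0 =
      ((mfderiv (𝓡∂ 5) 𝓘(ℝ, ℝ) ρ (b.incl x)).comp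
        (mfderivWithin ((𝓡 4).prod 𝓘(ℝ, ℝ)) (𝓡∂ 5) (uncurry D.toFun)
          ((univ : Set b.carrier) ×ˢ Ici (0 : ℝ)) (x, 0))).comp
        (mfderiv 𝓘(ℝ, ℝ) ((𝓡 4).prod 𝓘(ℝ, ℝ)) (fun t : ℝ => ((x, t) : b.carrier × ℝ)) 0) := by
    have : (fun t => ρ (D.toFun x t)) =
        (ρ ∘ uncurry D.toFun) ∘ fun t : ℝ => ((x, t) : b.carrier × ℝ) := rfl
    rw [this, mfderivWithin_comp 0 hρκ hc.mdifferentiableWithinAt hmaps hU1,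
      mfderiv_comp_mfderivWithin_of_eq hρ (mdifferentiableWithinAt_toFun D x) hU
        (D.apply_zero x), MDifferentiable.mfderivWithin hc hU1]
    rfl
  rw [← fderivWithin_derivWithin, ← mfderivWithin_eq_fderivWithin, key, mfderiv_prod_right]
  rfl

end Collar

/-- A function on `[0, ∞)` minimal at `0` has nonnegative right derivative at `0` (Fermat). -/
theorem derivWithin_Ici_nonneg_of_le {f : ℝ → ℝ} (hf : ∀ t, 0 ≤ t → f 0 ≤ f t) :
    0 ≤ derivWithin f (Ici 0) 0 := by
  have hmin : IsLocalMinOn f (Ici 0) 0 :=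
    Filter.eventually_of_mem self_mem_nhdsWithin fun t ht => hf t ht
  have hy : (1 : ℝ) ∈ posTangentConeAt (Ici (0 : ℝ)) 0 := by
    refine mem_posTangentConeAt_of_segment_subset ?_
    rw [zero_add]
    exact (convex_Ici (0 : ℝ)).segment_subset (mem_Ici.2 le_rfl) (mem_Ici.2 zero_le_one)
  rw [← fderivWithin_derivWithin]
  exact hmin.fderivWithin_nonneg hy

/-- **The normal pair at a boundary point (pointwise).** For the open collar `κ = D.toFun` of a
compact 5-manifold with boundary `X` along the boundary embedding `ι : M → ∂X`, a smooth
`ρ ≥ 0` vanishing exactly on `∂X` with a `ḡ`-unit gradient `ν` there (`ḡ` a `C²` metric with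
`ι^*ḡ = φ g₀`): `a₀ := ∂ₜ(ρ∘κ)(x,0⁺) > 0`, and there are `z ∈ TₓM`, `θ > 0` with
`ḡ(dκ(v + s z, s θ), dκ(v + s z, s θ)) = (θ a₀)² (s² + g₀(v,v))` for all `(v,s)` — namely
`(z, θ) = √φ · dκ⁻¹(ν)` (`dκ_{(x,0)}` is bijective: `d(proj,height) ∘ dκ = id`; `ν ⊥ dι(TM)`,
`dρ(ν) = 1`, `dρ ∘ dι = 0`). [folklore] -/
theorem stub_normalPairPointwise
    (M : Type) [TopologicalSpace M] [T2Space M] [SecondCountableTopology M]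
    [ChartedSpace (EuclideanSpace ℝ (Fin 4)) M] [IsManifold (𝓡 4) ∞ M] [CompactSpace M]
    (g₀ : Bundle.ContMDiffRiemannianMetric (𝓡 4) ∞ (EuclideanSpace ℝ (Fin 4))
      (TangentSpace (𝓡 4) : M → Type _))
    (X : Type) [TopologicalSpace X] [T2Space X] [SecondCountableTopology X]
    [ChartedSpace (EuclideanHalfSpace 5) X] [IsManifold (𝓡∂ 5) ∞ X] [CompactSpace X]
    (ι : M → X) (hι : Manifold.IsSmoothEmbedding (𝓡 4) (𝓡∂ 5) ∞ ι)
    (hιr : Set.range ι = (𝓡∂ 5).boundary X)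
    (ρ : X → ℝ) (hρ : ContMDiff (𝓡∂ 5) 𝓘(ℝ, ℝ) ∞ ρ) (hρ0 : ∀ x : X, 0 ≤ ρ x)
    (hρb : ∀ x : X, ρ x = 0 ↔ x ∈ (𝓡∂ 5).boundary X)
    (gb : Bundle.ContMDiffRiemannianMetric (𝓡∂ 5) 2 (EuclideanSpace ℝ (Fin 5))
      (TangentSpace (𝓡∂ 5) : X → Type _))
    (hν : ∀ y : M, ∃ ν : TangentSpace (𝓡∂ 5) (ι y), gb.inner (ι y) ν ν = 1 ∧
      ∀ v : TangentSpace (𝓡∂ 5) (ι y), gb.inner (ι y) ν v = mfderiv (𝓡∂ 5) 𝓘(ℝ, ℝ) ρ (ι y) v)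
    (φ : M → ℝ) (hφ : ∀ y : M, 0 < φ y ∧ ∀ v w : TangentSpace (𝓡 4) y,
      gb.inner (ι y) (mfderiv (𝓡 4) (𝓡∂ 5) ι y v) (mfderiv (𝓡 4) (𝓡∂ 5) ι y w) =
        φ y * g₀.inner y v w)
    (D : BoundaryData.OpenCollar (⟨M, ι, hι, hιr⟩ : BoundaryData (𝓡∂ 5) X (𝓡 4))) (x : M) :
    0 < derivWithin (fun t => ρ (D.toFun x t)) (Ici 0) 0 ∧
    ∃ (z : TangentSpace (𝓡 4) x) (θ : ℝ), 0 < θ ∧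
      ∀ (v : TangentSpace (𝓡 4) x) (s : ℝ),
        gb.inner (ι x)
            (mfderivWithin ((𝓡 4).prod 𝓘(ℝ, ℝ)) (𝓡∂ 5) (uncurry D.toFun) (univ ×ˢ Ici 0) (x, 0)
              (v + s • z, s * θ))
            (mfderivWithin ((𝓡 4).prod 𝓘(ℝ, ℝ)) (𝓡∂ 5) (uncurry D.toFun) (univ ×ˢ Ici 0) (x, 0)
              (v + s • z, s * θ)) =
          (θ * derivWithin (fun t => ρ (D.toFun x t)) (Ici 0) 0) ^ 2 *
            (s ^ 2 + g₀.inner x v v) := by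
  have hφx : 0 < φ x := (hφ x).1
  have hρd : MDifferentiableAt (𝓡∂ 5) 𝓘(ℝ, ℝ) ρ (ι x) := hρ.mdifferentiableAt (by simp)
  have hιd : MDifferentiableAt (𝓡 4) (𝓡∂ 5) ι x := hι.contMDiff.mdifferentiableAt (by simp)
  -- the players, as (bi)linear maps between the model spaces
  set G : EuclideanSpace ℝ (Fin 5) →L[ℝ] EuclideanSpace ℝ (Fin 5) →L[ℝ] ℝ := gb.inner (ι x)
    with hG
  set G₀ : EuclideanSpace ℝ (Fin 4) →L[ℝ] EuclideanSpace ℝ (Fin 4) →L[ℝ] ℝ := g₀.inner x with hG₀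
  set dκ : (EuclideanSpace ℝ (Fin 4) × ℝ) →L[ℝ] EuclideanSpace ℝ (Fin 5) :=
    mfderivWithin ((𝓡 4).prod 𝓘(ℝ, ℝ)) (𝓡∂ 5) (uncurry D.toFun) (univ ×ˢ Ici 0) (x, 0) with hdκ
  set L : EuclideanSpace ℝ (Fin 5) →L[ℝ] (EuclideanSpace ℝ (Fin 4) × ℝ) :=
    mfderiv (𝓡∂ 5) ((𝓡 4).prod 𝓘(ℝ, ℝ)) D.projHeight (ι x) with hL
  set dρ : EuclideanSpace ℝ (Fin 5) →L[ℝ] ℝ := mfderiv (𝓡∂ 5) 𝓘(ℝ, ℝ) ρ (ι x) with hdρ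
  set dι : EuclideanSpace ℝ (Fin 4) →L[ℝ] EuclideanSpace ℝ (Fin 5) :=
    mfderiv (𝓡 4) (𝓡∂ 5) ι x with hdι
  set a₀ : ℝ := derivWithin (fun t => ρ (D.toFun x t)) (Ici 0) 0 with ha₀
  -- the hypotheses at `x`, read in the model spaces
  have Gsymm : ∀ a e : EuclideanSpace ℝ (Fin 5), G a e = G e a := fun a e => gb.symm (ι x) a e
  obtain ⟨ν, hν1, hν2⟩ : ∃ ν : EuclideanSpace ℝ (Fin 5), G ν ν = 1 ∧
      ∀ e : EuclideanSpace ℝ (Fin 5), G ν e = dρ e := hν x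
  have hφ2 : ∀ v w : EuclideanSpace ℝ (Fin 4), G (dι v) (dι w) = φ x * G₀ v w := (hφ x).2
  -- (2) left inverse, bijectivity
  have hLK : ∀ w : EuclideanSpace ℝ (Fin 4) × ℝ, L (dκ w) = w :=
    fun w => mfderiv_projHeight_apply_mfderivWithin_toFun D x w
  have hinj : Function.Injective dκ := fun w w' h => by rw [← hLK w, ← hLK w', h]
  have hsurj : Function.Surjective dκ := by
    have hdim : Module.finrank ℝ (EuclideanSpace ℝ (Fin 4) × ℝ) =
        Module.finrank ℝ (EuclideanSpace ℝ (Fin 5)) := by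
      rw [Module.finrank_prod, finrank_euclideanSpace_fin, finrank_euclideanSpace_fin,
        Module.finrank_self]
    exact (LinearMap.injective_iff_surjective_of_finrank_eq_finrank hdim
      (f := (dκ : (EuclideanSpace ℝ (Fin 4) × ℝ) →ₗ[ℝ] EuclideanSpace ℝ (Fin 5)))).1 hinj
  have hKL : ∀ e : EuclideanSpace ℝ (Fin 5), dκ (L e) = e := by
    intro e
    obtain ⟨w, rfl⟩ := hsurj e
    rw [hLK]
  -- (3) horizontal vectors
  have hK0 : ∀ v : EuclideanSpace ℝ (Fin 4), dκ (v, 0) = dι v :=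
    fun v => mfderivWithin_toFun_apply_inl D x v
  -- (4) the normal derivative
  have ha₀' : a₀ = dρ (dκ (0, 1)) := derivWithin_comp_toFun D x hρd
  -- (5) `dρ ∘ dι = 0`
  have hρι : ∀ v : EuclideanSpace ℝ (Fin 4), dρ (dι v) = 0 := by
    intro v
    have h0 : ρ ∘ ι = fun _ => (0 : ℝ) := by
      funext y
      refine (hρb (ι y)).2 ?_
      rw [← hιr]
      exact mem_range_self y
    have h : mfderiv (𝓡 4) 𝓘(ℝ, ℝ) (ρ ∘ ι) x = 0 := by
      rw [h0, mfderiv_const]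
    have h2 : mfderiv (𝓡 4) 𝓘(ℝ, ℝ) (ρ ∘ ι) x v = dρ (dι v) := by
      rw [mfderiv_comp x hρd hιd]
      rfl
    rw [← h2, h]
    exact zero_apply _
  -- splitting `(v, s) = (v, 0) + s • (0, 1)`
  have hsplit : ∀ (v : EuclideanSpace ℝ (Fin 4)) (s : ℝ), dκ (v, s) = dι v + s • dκ (0, 1) := by
    intro v s
    have : ((v, s) : EuclideanSpace ℝ (Fin 4) × ℝ) =
        (v, 0) + s • ((0 : EuclideanSpace ℝ (Fin 4)), (1 : ℝ)) := by
      simp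
    rw [this, map_add, map_smul, hK0]
  have hρκ : ∀ (v : EuclideanSpace ℝ (Fin 4)) (s : ℝ), dρ (dκ (v, s)) = s * a₀ := by
    intro v s
    rw [hsplit, map_add, map_smul, hρι, ha₀', smul_eq_mul, zero_add]
  -- (6) `a₀ > 0`
  have hν3 : dρ ν = 1 := by rw [← hν2 ν, hν1]
  have hθ₀ : (L ν).2 * a₀ = 1 := by
    have h := hρκ (L ν).1 (L ν).2
    rw [Prod.mk.eta, hKL, hν3] at h
    exact h.symm
  have ha₀nn : 0 ≤ a₀ := by
    refine derivWithin_Ici_nonneg_of_le fun t _ => ?_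
    have h0 : ρ (D.toFun x 0) = 0 := by
      rw [D.apply_zero]
      refine (hρb _).2 ?_
      show ι x ∈ (𝓡∂ 5).boundary X
      rw [← hιr]
      exact mem_range_self x
    rw [h0]
    exact hρ0 _
  have ha₀pos : 0 < a₀ := by
    rcases ha₀nn.eq_or_lt with h | h
    · exfalso
      rw [← h, mul_zero] at hθ₀
      exact zero_ne_one hθ₀
    · exact h
  have hθ₀pos : 0 < (L ν).2 := by
    by_contra h
    have : (L ν).2 * a₀ ≤ 0 := mul_nonpos_of_nonpos_of_nonneg (not_lt.1 h) ha₀nn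
    linarith
  -- (7) the witnesses `z := c • (L ν).1`, `θ := c * (L ν).2`, `c := √(φ x)`
  set c : ℝ := Real.sqrt (φ x) with hc
  have hcpos : 0 < c := Real.sqrt_pos.2 hφx
  have hc2 : c ^ 2 = φ x := by
    rw [hc]
    exact Real.sq_sqrt hφx.le
  have hzθ : dκ (c • (L ν).1, c * (L ν).2) = c • ν := by
    have : ((c • (L ν).1, c * (L ν).2) : EuclideanSpace ℝ (Fin 4) × ℝ) = c • L ν := by
      rw [Prod.smul_mk, smul_eq_mul]
    rw [this, map_smul, hKL]
  have hw : ∀ (v : EuclideanSpace ℝ (Fin 4)) (s : ℝ),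
      dκ (v + s • (c • (L ν).1), s * (c * (L ν).2)) = dι v + (s * c) • ν := by
    intro v s
    have : ((v + s • (c • (L ν).1), s * (c * (L ν).2)) : EuclideanSpace ℝ (Fin 4) × ℝ) =
        (v, 0) + s • (c • (L ν).1, c * (L ν).2) := by
      rw [Prod.smul_mk, Prod.mk_add_mk, zero_add, smul_eq_mul]
    rw [this, map_add, map_smul, hK0, hzθ, smul_smul]
  have hθa : c * (L ν).2 * a₀ = c := by rw [mul_assoc, hθ₀, mul_one]
  -- (8) the identity
  have key : ∀ (v : EuclideanSpace ℝ (Fin 4)) (s : ℝ),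
      G (dκ (v + s • (c • (L ν).1), s * (c * (L ν).2)))
        (dκ (v + s • (c • (L ν).1), s * (c * (L ν).2))) =
      (c * (L ν).2 * a₀) ^ 2 * (s ^ 2 + G₀ v v) := by
    intro v s
    rw [hw, hθa]
    have h1 : G (dι v) (dι v) = c ^ 2 * G₀ v v := by
      rw [hc2]
      exact hφ2 v v
    have h2 : G ν (dι v) = 0 := by rw [hν2, hρι]
    have h3 : G (dι v) ν = 0 := by rw [Gsymm, h2]
    simp only [map_add, map_smul, add_apply, smul_apply, smul_eq_mul, h1, h2, h3, hν1]
    ring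
  refine ⟨ha₀pos, c • (L ν).1, c * (L ν).2, mul_pos hcpos hθ₀pos, fun v s => ?_⟩
  exact key v s

end Summit.SmoothPoincare4.SmoothPoincare4.Cruxes.AhHadamardFilling.EinsteinBulkTransfer

end
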